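import Summits.BirchSwinnertonDyer.BirchSwinnertonDyer.Theorems.PrintCf2SplitBadTwoCMShaLocalDescent
import Summits.BirchSwinnertonDyer.BirchSwinnertonDyer.Theorems.PrintCf2SplitBadTwoCMShaDescentSurjective
import HarnessLib

/-!
# Crux `PrintCf2.SplitBadTwoRankOneOfFacts` (item stmt-BirchSwinnertonDyer-20368), road α over the CM field:
# `#Ш(W_{K₀}/K₀)[2^∞] = (#Ш(W/ℚ)[2^∞])²` and `#Ш(W_{K₀})[𝔭^∞] = #Ш(W_{K₀})[𝔭̄^∞] = #Ш(W/ℚ)[2^∞]` for `j = −3375`, `K₀ = ℚ(√−7)`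

Cell `bsd-print-cf2`, width seat `bsd-line-cf2-p1-w8` g2 (brick **B6e**, conclusion: the Ш-side CM bookkeeping of memo
`Cruxes/SplitBadTwoRankOneOfFacts/SHA-CM-DESCENT-w8g0.md` with its «one missing piece» now in the kernel); `--supports
stmt-BirchSwinnertonDyer-20368` (helper). HONEST FRAMING: nothing here closes a crux or a stub; BSD is not proved by any of this; no summit
statement is proved by this seat. No definition is introduced. beyond-print theorem: no.

For `W/ℚ` elliptic with `j = −3375` and `K` imaginary quadratic with `θ² = −7` (`K = K₀ = ℚ(√−7)`), `σ ≠ 1` in `Aut(K/ℚ)`, `τ` ANY lift: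
* `exists_sha_two_primary_eq_of_fixed` — every `τ_*`-FIXED element of `Ш(W_K/K)[2^∞]` is the restriction of a (unique) element of
  `Ш(W/ℚ)[2^∞]`: exact `C₂`-descent of `H¹` (-w8 g0 B6c `resBaseChange_injective_of_cm` + B6d
  `exists_resBaseChange_eq_of_conjH1Points_eq_cm'`) + the EXACT LOCAL DESCENT `mem_sha_of_resBaseChange_mem_sha_cm7` (this seat, B6e-i);
* **`natCard_sha_two_primary_eq_natCard_fixed`** — `res : Ш(W/ℚ)[2^∞] ⥲ Ш(W_K/K)[2^∞]^{τ_*}` is a bijection, `#Ш(W/ℚ)[2^∞] = #ker(s − id)`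
  for the involution `s = τ_*` of B6b;
* **`natCard_sha_two_primary_baseChange_eq_sq`** — `#Ш(W_K/K)[2^∞] = (#Ш(W/ℚ)[2^∞])²`, `ord₂ #Ш(W_K/K)[2^∞] = 2·ord₂ #Ш(W/ℚ)[2^∞]`;
* **`natCard_cmPrimary_sha_eq_natCard_sha_two_primary`** — for EVERY `2`-adic root `r` of `X² − X + 2` and the eigen-subgroup
  `C = Ш[𝔭^∞]` (`Ш(φ)` acts as `r`, -w2 g7's integer-approximation currency): `#C = #Ш(W/ℚ)[2^∞]` — Agboola's `#Ш(K₀)(𝔭*)` (§6,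
  Prop. 8.1) IS Miller's `#Ш(W/ℚ)[2^∞]`, correction ZERO, which is the `Ш`-summand of S3c₂ `stub_restrictedEulerCharBottom_two`.
* `natCard_cmPrimary_sha_eq_of_isogeny` — the same for ANY endo-isogeny `φ` with `φ² = φ − 2` and BOTH eigen-subgroups (consumer form).
`Nat.card` throughout, NO finiteness of `Ш` assumed (infinite groups read `0 = 0`).

References: B. H. Gross, LMS LNS 153 (1991) §5 (5.1) [GrossLMS1991]; K. Rubin, Invent. Math. 107 (1992) Cor. 10.3 (shape); A. Agboola,
§6 and Prop. 8.1 (the consumer) [Agboola2007]; [SilvermanATAEC1994] II §2 Thm. 2.2(b); J.-P. Serre, *Galois Cohomology*, I.§2.4, I.§5.8.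
-/

noncomputable section

open scoped Classical

set_option linter.dupNamespace false
set_option autoImplicit false

namespace Summit.BirchSwinnertonDyer.BirchSwinnertonDyer.Theorems.PrintCf2.CMPrimes

open WeierstrassCurve Literature.NumberTheory.EllipticCurves Field NumberField
open Summit.BirchSwinnertonDyer.BirchSwinnertonDyer.Theorems

section Descent

variable (W : WeierstrassCurve ℚ) [W.IsElliptic] {K : Type} [Field K] [NumberField K]

/-- **A `τ_*`-fixed class of `Ш(W_K/K)[2^∞]` descends to `Ш(W/ℚ)[2^∞]`.** `W/ℚ` elliptic, `j = −3375`, `K` imaginary quadratic with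
`θ² = −7`, `σ ≠ 1`, `τ` any lift of `σ`: if `y ∈ Ш(W_K/K)[2^∞]` satisfies `τ_* y = y` then `y = res c` for some `c ∈ Ш(W/ℚ)[2^∞]`
(as classes of `H¹(K, W_K)`): `c ∈ H¹(ℚ, W)` exists by B6d (`exists_resBaseChange_eq_of_conjH1Points_eq_cm'`), lies in `Ш(W/ℚ)` by the
exact local descent `mem_sha_of_resBaseChange_mem_sha_cm7`, and is `2`-primary because `res` is injective (B6c
`resBaseChange_injective_of_cm`). [cite: GrossLMS1991, §5 (5.1)] [cite: SerreGaloisCohomology1997, I.§2.4 (Prop. 9 and Cor.) and I.§5.8] -/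
theorem exists_sha_two_primary_eq_of_fixed (hj : W.j = -3375) (hKq : IsImaginaryQuadratic K) {θ : K} (hθ : θ ^ 2 = -7)
    {σ : K ≃ₐ[ℚ] K} (hσ : σ ≠ 1) {τ : AlgebraicClosure K ≃+* AlgebraicClosure K} (hτ : IsLiftOfAut σ τ)
    (y : AddCommGroup.primaryComponent (W.baseChange K).sha 2)
    (hy : hτ.conjH1Points W ((y : (W.baseChange K).sha) : (W.baseChange K).galH1) =
      ((y : (W.baseChange K).sha) : (W.baseChange K).galH1)) :
    ∃ c : AddCommGroup.primaryComponent W.sha 2,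
      (shaRestriction W K (c : W.sha) : (W.baseChange K).galH1) = ((y : (W.baseChange K).sha) : (W.baseChange K).galH1) := by
  haveI : Fact (Nat.Prime 2) := ⟨Nat.prime_two⟩
  obtain ⟨c, hc⟩ := exists_resBaseChange_eq_of_conjH1Points_eq_cm' K W hj hKq.1 hθ hσ hτ hy
  have hcsha : c ∈ W.sha :=
    mem_sha_of_resBaseChange_mem_sha_cm7 W hj K hθ hKq.1 (by rw [hc]; exact (y : (W.baseChange K).sha).2)
  -- `c` is `2`-primary: `res (2^k c) = 2^k y = 0` and `res` is injective
  obtain ⟨k, hk⟩ := exists_two_pow_smul_eq_zero_primaryComponent y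
  have hk' : 2 ^ k • ((y : (W.baseChange K).sha) : (W.baseChange K).galH1) = 0 := by
    have h := congrArg (fun z : AddCommGroup.primaryComponent (W.baseChange K).sha 2 ↦ ((z : (W.baseChange K).sha) : (W.baseChange K).galH1)) hk
    simpa using h
  have hck : 2 ^ k • c = 0 := by
    apply resBaseChange_injective_of_cm W K hj hKq.1 hθ hσ
    rw [map_nsmul, hc, hk', map_zero]
  have hprim : (⟨c, hcsha⟩ : W.sha) ∈ AddCommGroup.primaryComponent W.sha 2 :=
    AddCommGroup.mem_primaryComponent.mpr ⟨k, Subtype.ext (by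
      rw [AddSubmonoidClass.coe_nsmul, ZeroMemClass.coe_zero]; exact hck)⟩
  exact ⟨⟨⟨c, hcsha⟩, hprim⟩, by rw [coe_shaRestriction_apply]; exact hc⟩

/-- **`#Ш(W/ℚ)[2^∞] = #Ш(W_K/K)[2^∞]^{τ_*}`.** With `s` the involution of `M = Ш(W_K/K)[2^∞]` over `τ_*` (B6b), restriction
`c ↦ res c` is a BIJECTION `Ш(W/ℚ)[2^∞] ⥲ ker(s − id)`: it lands in the fixed part (`conjH1Points_shaRestriction`), is injective (B6c
`shaRestriction_injective_of_isImaginaryQuadratic`) and surjective (`exists_sha_two_primary_eq_of_fixed`). `Nat.card`; no finiteness.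
[cite: GrossLMS1991, §5 (5.1)] [cite: SerreGaloisCohomology1997, I.§2.4 (Prop. 9 and Cor.) and I.§5.8] -/
theorem natCard_sha_two_primary_eq_natCard_fixed (hj : W.j = -3375) (hKq : IsImaginaryQuadratic K) {θ : K} (hθ : θ ^ 2 = -7)
    {σ : K ≃ₐ[ℚ] K} (hσ : σ ≠ 1) {τ : AlgebraicClosure K ≃+* AlgebraicClosure K} (hτ : IsLiftOfAut σ τ)
    (s : AddCommGroup.primaryComponent (W.baseChange K).sha 2 →+ AddCommGroup.primaryComponent (W.baseChange K).sha 2)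
    (hs : ∀ x, (((s x : AddCommGroup.primaryComponent (W.baseChange K).sha 2) : (W.baseChange K).sha) : (W.baseChange K).galH1) =
      hτ.conjH1Points W ((x : (W.baseChange K).sha) : (W.baseChange K).galH1)) :
    Nat.card (AddCommGroup.primaryComponent W.sha 2) = Nat.card (s - AddMonoidHom.id _).ker := by
  haveI : Fact (Nat.Prime 2) := ⟨Nat.prime_two⟩
  set M := ↥(AddCommGroup.primaryComponent (W.baseChange K).sha 2) with hM_def
  have hinj := shaRestriction_injective_of_isImaginaryQuadratic W K hj hKq hθ
  have hmem : ∀ c : AddCommGroup.primaryComponent W.sha 2,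
      shaRestriction W K (c : W.sha) ∈ AddCommGroup.primaryComponent (W.baseChange K).sha 2 := fun c ↦
    map_mem_primaryComponent (shaRestriction W K) c.2
  have hfix : ∀ c : AddCommGroup.primaryComponent W.sha 2,
      (⟨shaRestriction W K (c : W.sha), hmem c⟩ : M) ∈ (s - AddMonoidHom.id M).ker := fun c ↦ by
    rw [AddMonoidHom.mem_ker, AddMonoidHom.sub_apply, AddMonoidHom.id_apply, sub_eq_zero]
    apply Subtype.ext; apply Subtype.ext
    rw [hs]
    exact conjH1Points_shaRestriction W K hτ (c : W.sha)
  let f : AddCommGroup.primaryComponent W.sha 2 → (s - AddMonoidHom.id M).ker :=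
    fun c ↦ ⟨⟨shaRestriction W K (c : W.sha), hmem c⟩, hfix c⟩
  refine Nat.card_congr (Equiv.ofBijective f ⟨fun c c' h ↦ ?_, fun y ↦ ?_⟩)
  · have h' : shaRestriction W K (c : W.sha) = shaRestriction W K (c' : W.sha) :=
      congrArg Subtype.val (congrArg Subtype.val h)
    exact Subtype.ext (hinj h')
  · -- surjectivity: a fixed `y` descends
    have hy : hτ.conjH1Points W (((y : M) : (W.baseChange K).sha) : (W.baseChange K).galH1) =
        (((y : M) : (W.baseChange K).sha) : (W.baseChange K).galH1) := by
      have h0 : (s - AddMonoidHom.id M) (y : M) = 0 := (AddMonoidHom.mem_ker).mp y.2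
      rw [AddMonoidHom.sub_apply, AddMonoidHom.id_apply, sub_eq_zero] at h0
      rw [← hs, h0]
    obtain ⟨c, hc⟩ := exists_sha_two_primary_eq_of_fixed W hj hKq hθ hσ hτ (y : M) hy
    exact ⟨c, Subtype.ext (Subtype.ext (Subtype.ext hc))⟩

/-- **`#Ш(W_{K₀}/K₀)[2^∞] = (#Ш(W/ℚ)[2^∞])²` for the split-bad CM class.** `W/ℚ` elliptic with `j = −3375`, `K` imaginary quadratic
with `θ² = −7`. By B6b (`exists_cm_involution_card_sha_of_isImaginaryQuadratic`: `#Ш(W_K)[2^∞] = #ker(s − id)²`) and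
`natCard_sha_two_primary_eq_natCard_fixed`. `Nat.card`, no finiteness of `Ш` assumed (both sides `0` for infinite `Ш[2^∞]`).
[cite: GrossLMS1991, §5 (5.1)] [cite: SilvermanATAEC1994, II §1 Prop. 1.1, II §2 Thm. 2.2(b), App. A §3 (row D = -7)] -/
theorem natCard_sha_two_primary_baseChange_eq_sq (hj : W.j = -3375) (hKq : IsImaginaryQuadratic K) {θ : K} (hθ : θ ^ 2 = -7) :
    Nat.card (AddCommGroup.primaryComponent (W.baseChange K).sha 2) = Nat.card (AddCommGroup.primaryComponent W.sha 2) ^ 2 := by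
  obtain ⟨σ, hσ⟩ := exists_algEquiv_ne_one_of_finrank_eq_two K hKq.1
  have hτ := isLiftOfAut_liftAut σ
  obtain ⟨φ, s, -, -, hs, -, hsq, -⟩ := exists_cm_involution_card_sha_of_isImaginaryQuadratic W hj hKq hθ hσ hτ
  rw [hsq, natCard_sha_two_primary_eq_natCard_fixed W hj hKq hθ hσ hτ s hs]

/-- `ord₂ #Ш(W_{K₀}/K₀)[2^∞] = 2 · ord₂ #Ш(W/ℚ)[2^∞]` (`Nat.card`; for infinite `Ш[2^∞]` both sides read `0`). [cite: GrossLMS1991, §5 (5.1)] -/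
theorem padicValNat_card_sha_two_primary_baseChange_eq_two_mul (hj : W.j = -3375) (hKq : IsImaginaryQuadratic K) {θ : K}
    (hθ : θ ^ 2 = -7) :
    padicValNat 2 (Nat.card (AddCommGroup.primaryComponent (W.baseChange K).sha 2)) =
      2 * padicValNat 2 (Nat.card (AddCommGroup.primaryComponent W.sha 2)) := by
  haveI : Fact (Nat.Prime 2) := ⟨Nat.prime_two⟩
  rw [natCard_sha_two_primary_baseChange_eq_sq W hj hKq hθ, padicValNat.pow]

/-- **`#Ш(W_{K₀}/K₀)[𝔭^∞] = #Ш(W_{K₀}/K₀)[𝔭̄^∞] = #Ш(W/ℚ)[2^∞]`: Agboola's `Ш(K₀)(𝔭*)`-count IS Miller's `Ш(W/ℚ)[2^∞]`-count, correction ZERO.**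
For `W/ℚ` elliptic with `j = −3375` and `K` imaginary quadratic with `θ² = −7` there is the complex multiplication `φ` (endo-isogeny of
`W_K`, `φ(φP) = φP − 2P`, `#ker φ = 2`; -w8 g0 B6b) such that for EVERY `2`-adic root `r` of `X² − X + 2` and the eigen-subgroup
`C ≤ Ш(W_K/K)[2^∞]` on which `Ш(φ)` acts as `r` (-w2 g7's integer-approximation currency, read on `H¹(K, W_K)`): `#C = #Ш(W/ℚ)[2^∞]`
(`Nat.card`; no finiteness). This is the `Ш`-summand of S3c₂ `stub_restrictedEulerCharBottom_two`'s conclusion in `ℚ`-currency.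
[cite: GrossLMS1991, §5 (5.1)] [cite: SilvermanATAEC1994, II §1 Prop. 1.1, II §2 Thm. 2.2(b), App. A §3 (row D = -7)] -/
theorem exists_cmIsogeny_natCard_cmPrimary_sha_eq (hj : W.j = -3375) (hKq : IsImaginaryQuadratic K) {θ : K} (hθ : θ ^ 2 = -7) :
    ∃ φ : Isogeny (W.baseChange K) (W.baseChange K), (∀ P, φ (φ P) = φ P - 2 • P) ∧ Nat.card φ.toAddMonoidHom.ker = 2 ∧
      ∀ {r : ℤ_[2]}, r * r = r - 2 →
      ∀ {C : AddSubgroup (AddCommGroup.primaryComponent (W.baseChange K).sha 2)},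
        (∀ x, x ∈ C ↔ ∀ (k : ℕ) (N : ℤ), 2 ^ k • x = 0 →
          ((N : ℤ_[2]) - r) ∈ (Ideal.span {(2 : ℤ_[2]) ^ k} : Ideal ℤ_[2]) →
            galH1Map φ.toAddMonoidHom φ.equivariant
                (((x : AddCommGroup.primaryComponent (W.baseChange K).sha 2) : (W.baseChange K).sha) : (W.baseChange K).galH1) =
              N • (((x : AddCommGroup.primaryComponent (W.baseChange K).sha 2) : (W.baseChange K).sha) :
                (W.baseChange K).galH1)) →
        Nat.card C = Nat.card (AddCommGroup.primaryComponent W.sha 2) := by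
  obtain ⟨σ, hσ⟩ := exists_algEquiv_ne_one_of_finrank_eq_two K hKq.1
  have hτ := isLiftOfAut_liftAut σ
  obtain ⟨φ, s, hrel, hker, hs, -, -, hC⟩ := exists_cm_involution_card_sha_of_isImaginaryQuadratic W hj hKq hθ hσ hτ
  refine ⟨φ, hrel, hker, fun hr C hCdef ↦ ?_⟩
  rw [← (hC hr hCdef).1, natCard_sha_two_primary_eq_natCard_fixed W hj hKq hθ hσ hτ s hs]

/-- **For ANY complex multiplication and EITHER CM prime: `#Ш(W_{K₀}/K₀)[𝔭^∞] = #Ш(W_{K₀}/K₀)[𝔭̄^∞] = #Ш(W/ℚ)[2^∞]`.**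
`W/ℚ` elliptic with `j = −3375`, `K` imaginary quadratic with `θ² = −7`, `φ` ANY endo-isogeny of `W_K` with `φ(φP) = φP − 2P` (so
`φ = π` or `π̄`), `r` any `2`-adic root of `X² − X + 2`, `C`, `C'` the eigen-subgroups of `Ш(W_K/K)[2^∞]` for `r`, `1 − r`: then
`#C = #C' = #Ш(W/ℚ)[2^∞]` — from `(#C)² = #Ш(W_K)[2^∞]` (-w8 g0 B6 `card_sha_two_primary_eq_sq`, ANY `φ`) and
`natCard_sha_two_primary_baseChange_eq_sq`. The form a consumer holding ITS OWN `π` (S3c₂'s binder) cites by name.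
[cite: GrossLMS1991, §5 (5.1)] [cite: SilvermanATAEC1994, II §1 Prop. 1.1, II §2 Thm. 2.2(b), App. A §3 (row D = -7)] -/
theorem natCard_cmPrimary_sha_eq_of_isogeny (hj : W.j = -3375) (hKq : IsImaginaryQuadratic K) {θ : K} (hθ : θ ^ 2 = -7)
    (φ : Isogeny (W.baseChange K) (W.baseChange K)) (hrel : ∀ P, φ (φ P) = φ P - 2 • P) {r : ℤ_[2]} (hr : r * r = r - 2)
    {C C' : AddSubgroup (AddCommGroup.primaryComponent (W.baseChange K).sha 2)}
    (hC : ∀ x, x ∈ C ↔ ∀ (k : ℕ) (N : ℤ), 2 ^ k • x = 0 →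
      ((N : ℤ_[2]) - r) ∈ (Ideal.span {(2 : ℤ_[2]) ^ k} : Ideal ℤ_[2]) →
        galH1Map φ.toAddMonoidHom φ.equivariant
            (((x : AddCommGroup.primaryComponent (W.baseChange K).sha 2) : (W.baseChange K).sha) : (W.baseChange K).galH1) =
          N • (((x : AddCommGroup.primaryComponent (W.baseChange K).sha 2) : (W.baseChange K).sha) : (W.baseChange K).galH1))
    (hC' : ∀ x, x ∈ C' ↔ ∀ (k : ℕ) (N : ℤ), 2 ^ k • x = 0 →
      ((N : ℤ_[2]) - (1 - r)) ∈ (Ideal.span {(2 : ℤ_[2]) ^ k} : Ideal ℤ_[2]) →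
        galH1Map φ.toAddMonoidHom φ.equivariant
            (((x : AddCommGroup.primaryComponent (W.baseChange K).sha 2) : (W.baseChange K).sha) : (W.baseChange K).galH1) =
          N • (((x : AddCommGroup.primaryComponent (W.baseChange K).sha 2) : (W.baseChange K).sha) : (W.baseChange K).galH1)) :
    Nat.card C = Nat.card (AddCommGroup.primaryComponent W.sha 2) ∧
      Nat.card C' = Nat.card (AddCommGroup.primaryComponent W.sha 2) := by
  haveI : IsGalois ℚ K := Literature.FieldTheory.Galois.isGalois_of_finrank_eq_two (F := ℚ) hKq.1
  haveI : IsTotallyComplex K := hKq.2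
  have hK : ∀ w : InfinitePlace K, w.IsComplex := fun w ↦ IsTotallyComplex.isComplex w
  obtain ⟨-, hsq, hsq'⟩ := card_sha_two_primary_eq_sq W hK φ hrel hr hC hC'
  have h := natCard_sha_two_primary_baseChange_eq_sq W hj hKq hθ
  exact ⟨Nat.pow_left_injective two_ne_zero (hsq.symm.trans h), Nat.pow_left_injective two_ne_zero (hsq'.symm.trans h)⟩

end Descent

end Summit.BirchSwinnertonDyer.BirchSwinnertonDyer.Theorems.PrintCf2.CMPrimes

end
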